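/-
Copyright: statement-level skeleton of a published paper (lit-balaban cell, Phase-2 proof seat p39 gen 5). No proof claims
beyond what the kernel checks below.
-/
import Literature.MathematicalPhysics.QuantumFieldTheory.Balaban1983to89.B3GkZeroTorusPointwise
import Literature.MathematicalPhysics.QuantumFieldTheory.Balaban1983to89.B3Bound323

/-!
# B3 — T. Bałaban, *(Higgs)₂,₃ quantum fields in a finite volume. III. Renormalization*, CMP **88** (1983) 411–445
[Balaban1983Higgs3], p. 439 [PDF 29]: **"the expression in the square bracket in (3.23) containing the second term will be
convergent"** — PROVED WITH THE KERNEL BOUNDS DISCHARGED for the ACTUAL zero-field resummed propagators of the torus,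
`G^ξ_{j″}(0) = G^ξ_{j″} = G_k(T_ε, 0)` (the model instance `A = B̃ = 0`), every volume and every scale, `d = 3`

statement-level skeleton of published theorems with citation tags; proofs where landed; nothing here is a claim about
the Yang–Mills mass gap

PDF held: `paper:balaban1983-higgs-2-3-quantum-fields-finite-volume` (journal page = PDF page + 410); p. 439 [PDF 29] and p. 437
[PDF 27] read in the OCR text.  Rows **B3.Eq3.21-3.24** / **B3.Eq3.11-3.17** of `HOME/lit-balaban-r15/ROWS-B3.md` (fold owner r15).
THIS FILE joins two landed pieces of this seat: `B3Bound323.abs_second323_le` (the p. 439 second-term convergence under the printed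
kernel bounds, hypotheses `hM`, `hG` in the distance `ξ·supDist`) and `B3GkZeroTorusPointwise.gk_zero_torus_pointwise_eta` (the p. 437
bounds `|G^η_k(x,x′)| ≤ c₁dist^{−1}e^{−δ₁dist}`, `|(∂^ε_μG^η_k)(x,x′)| ≤ c₁dist^{−2}e^{−δ₁dist}` for Bałaban's scalar torus tower at zero
field, in the torus metric `B5Ineq137Torus.T`).
* §1 THE METRIC DICTIONARY **`T_eq_supDist`**: the sup torus distance of the B4/B5 torus lineage (`B5Ineq137Torus.T`, through
  `B4Sect5Torus.tdist`/`B4TorusKernel.MultiPeriod.circAbs`) IS r15's `LatticeFieldCalculus.supDist` (through `B3TorusRadialSums.cdist`),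
  on every level `Site P j` — coordinatewise `dist(x_μ − y_μ, Nℤ) = min((x_μ−y_μ).val, (y_μ−x_μ).val)` (`ccoord_toT_eq_cdist`).
* §2 THE KERNEL DICTIONARY: for the `η^d`-normalised kernel `G^η(y,y′) = ε^{−d}G(y,y′)` of a matrix `G` on the fine torus, r15's
  derivative kernel is the B1/B5 difference matrix: `(∂^ε_μG^η)(y,y′) = d1Kernel ε⁻¹ μ G^η y y′ = ε^{−d}·(deriv P 0 ε μ * G)(y,y′)`
  (`d1Kernel_etaKernel`, by `B5Leaf235Torus.deriv_mul_apply`).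
* §3 **`second323_zero_torus`**: for odd `L > 1`, `a > 0`, `m² ≥ 0` there are `δ₁, c₁ > 0` such that for EVERY volume
  `P = (3, L, m, K)`, every `1 ≤ k ≤ K`, every `K′ ≥ 0`, all localization functions `|g| ≤ 1` and Lipschitz `g′`
  (`|g′(y′) − g′(y)| ≤ K′ε|y − y′|₁`), every direction `μ` and site `y`:
  `|Σ_{y′}ε³(∂^ε_μG^η_k)(y,y′)g(y)G^η_k(y,y′)(g′(y′) − g′(y))| ≤ 3c₁²K′·radialConst 3 δ₁ 1 0` — ONE constant for all spacings
  `ε = L^{−K}`, scales and volumes (`B3Bound323.abs_second323_le_uniform` with `hM`, `hG` := §2 + `gk_zero_torus_pointwise_eta` + §1);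
  `bracket323_zero_torus`: the same for r15's `[(3.23)](y)` minus its first term (`abs_bracket323_sub_first_le`).
HONEST SCOPE: `d = 3`; `A = B̃ = 0`, `U ≡ 1`, one component, Ω = the whole torus (the scope of `B4Thm110ZeroTorus`); both propagators of
(3.23) specialised to the SAME zero-field `G_k(T_ε,0)` (at zero field `G_{j″}(0) = G_{j″}`), on the fine torus of spacing `ε` (the
print's rescaling to `ξ = L^{−j″}` is a change of units under which both sides are invariant); the Lipschitz form of `g′` is the stated
reading of the printed `(g′(x′) − g′(x))/|x′−x| · |x′−x|`; the FIRST term of the split (3.23) bracket is not treated here (torus free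
propagator: `B3Eq324Torus`).  Mathlib + the cited tree files only; theorems only, no new definitions, no named facts; standard axioms.
Unit `lit-balaban-p39-g5` (Phase-2 proof seat p39, gen 5), HOME `run/shared/lean/pub/lit-balaban/`, 2026-08-21.
-/

open scoped BigOperators

namespace Literature.MathematicalPhysics.QuantumFieldTheory.Balaban1983to89.B3Bound323ZeroTorus

open Matrix B1RG242Torus B5Display136Torus B5Ineq137Torus B4Thm110ZeroTorus B3GkZeroTorusPointwise
open LatticeFieldCalculus B3Sect3ScalarSelfEnergy B3TorusRadialSums B3Bound316 B3Bound323

noncomputable section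

/-! ## 1. The metric dictionary: `T = supDist` -/

section Metric

variable (P : Params) {j : ℕ}

/-- kernel: the circular coordinate distance of the B4 torus lineage is r15's `cdist` of the coordinate difference:
`dist(x_μ − y_μ, Nℤ) = min((x_μ − y_μ).val, (−(x_μ − y_μ)).val)` — two transcriptions of the torus distance `|x − y|` of
[Balaban1982Higgs1] (1.3). [cite: Balaban1982Higgs1, (1.3) p.604] -/
theorem ccoord_toT_eq_cdist (x y : Site P j) (μ : Fin P.d) :
    B4Sect5Torus.ccoord (Nv P j) (toT x) (toT y) μ = cdist (x μ - y μ) := by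
  set N : ℕ := P.sitesPerDir j with hN
  set m : ZMod (P.sitesPerDir j) := x μ - y μ with hm
  -- the residue of the integer difference is the value of the `ZMod` difference
  have hmod : (((x μ).val : ℤ) - ((y μ).val : ℤ)) % (N : ℤ) = (m.val : ℤ) := by
    have h := ZMod.val_intCast (n := P.sitesPerDir j) (((x μ).val : ℤ) - ((y μ).val : ℤ))
    rw [← h]
    congr 2
    rw [hm, Int.cast_sub, Int.cast_natCast, Int.cast_natCast, ZMod.natCast_zmod_val, ZMod.natCast_zmod_val]
  have hmN : m.val < N := ZMod.val_lt m
  show (min ((((x μ).val : ℤ) - ((y μ).val : ℤ)) % (N : ℤ))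
      ((N : ℤ) - (((x μ).val : ℤ) - ((y μ).val : ℤ)) % (N : ℤ))).toNat = cdist m
  rw [hmod, cdist, ZMod.neg_val]
  by_cases h0 : m = 0
  · rw [if_pos h0, h0, ZMod.val_zero]
    simp
  · rw [if_neg h0]
    have h1 : ((N : ℤ) - (m.val : ℤ)) = ((N - m.val : ℕ) : ℤ) := by
      rw [Nat.cast_sub hmN.le]
    rw [h1, ← Nat.cast_min, Int.toNat_natCast]

/-- **THE METRIC DICTIONARY**: the sup torus distance of the B4/B5 torus lineage IS r15's `supDist`, on every level:
`T P j x y = |x − y|_∞` (lattice units) — the sup form of the torus distance `|x − y|` of [Balaban1982Higgs1] (1.3) in its two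
transcriptions (`B5Ineq137Torus.T`, `LatticeFieldCalculus.supDist`). [cite: Balaban1982Higgs1, (1.3) p.604] -/
theorem T_eq_supDist (x y : Site P j) : T P j x y = (supDist x y : ℝ) := by
  unfold T B4Sect5Torus.tdist
  rw [supDist_eq_sup_cdist]
  congr 1
  exact Finset.sup_congr rfl fun μ _ => ccoord_toT_eq_cdist P x y μ

end Metric

/-! ## 2. The kernel dictionary: r15's derivative kernel of the η-normalised kernel is the B1/B5 difference matrix -/

section KernelDict

variable (P : Params)

/-- **THE KERNEL DICTIONARY**: for `G^η(y,y′) = ε^{−d}G(y,y′)`, r15's `(∂^ε_μG^η)(y,y′) = d1Kernel ε⁻¹ μ G^η y y′` equals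
`ε^{−d}·(deriv P 0 ε μ * G)(y,y′)` (`B5Leaf235Torus.deriv_mul_apply`: both are `ε^{−1}(G(y+e_μ,y′) − G(y,y′))`, the kernel
`(∂^η_μG^η_{j″}(0))(x,x′)` of (3.23) in its two transcriptions). [cite: Balaban1983Higgs3, (3.23) p.439] -/
theorem d1Kernel_etaKernel (G : Matrix (Site P 0) (Site P 0) ℝ) (μ : Fin P.d) (y y' : Site P 0) :
    d1Kernel P.eps⁻¹ μ (fun z z' => (P.eps ^ P.d)⁻¹ * G z z') y y' = (P.eps ^ P.d)⁻¹ * (deriv P 0 P.eps μ * G) y y' := by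
  rw [B5Leaf235Torus.deriv_mul_apply]
  simp only [d1Kernel]
  ring

end KernelDict

/-! ## 3. p. 439 second-term convergence with the kernel bounds DISCHARGED for G_k(T_ε, 0) -/

section Instance

/-- **p. 439 [PDF 29], «the expression in the square bracket in (3.23) containing the second term will be convergent» — FOR THE ZERO-FIELD
RESUMMED PROPAGATORS OF THE TORUS, HYPOTHESIS-FREE IN THE PROPAGATORS.**  For odd `L > 1`, `a > 0`, `m² ≥ 0` there are `δ₁, c₁ > 0`
(functions of `L, a, m²`) such that for EVERY volume `P = (3, L, m, K)` of Bałaban's scalar torus tower, every scale `1 ≤ k ≤ K`, with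
`G^ξ_{j″}(0) = G^ξ_{j″} := G^η_k = ε^{−3}G_k(T_ε,0)` (`ξ = ε`), every `K′ ≥ 0`, all `|g| ≤ 1` and `g′` with `|g′(y′) − g′(y)| ≤ K′ε|y − y′|₁`,
every `μ` and `y`: `|Σ_{y′}ε³(∂^ε_μG^η_k)(y,y′)g(y)G^η_k(y,y′)(g′(y′) − g′(y))| ≤ 3·c₁·c₁·K′·radialConst 3 δ₁ 1 0` — one constant for all
spacings, scales and volumes (`B3Bound323.abs_second323_le_uniform` with `hM`, `hG` discharged by `gk_zero_torus_pointwise_eta` through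
§1–§2). [cite: Balaban1983Higgs3, (3.23) p.439, p.437 (kernel bounds); Balaban1983RegularityDecay, (2.34)–(2.39) p.582] -/
theorem second323_zero_torus (L : ℕ) (hL : Odd L ∧ 1 < L) {a : ℝ} (ha : 0 < a) {msq : ℝ} (hmsq : 0 ≤ msq) :
    ∃ δ₁ c₁ : ℝ, 0 < δ₁ ∧ 0 < c₁ ∧ ∀ (P : Params) (hd : P.d = 3), P.L = L →
      ∀ k : ℕ, 1 ≤ k → k ≤ P.K → ∀ (K' : ℝ), 0 ≤ K' →
        ∀ (g g' : SiteField P 0 ℝ) (μ : Fin P.d), (∀ y, |g y| ≤ 1) →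
          (∀ y y' : Site P 0, |g' y' - g' y| ≤ K' * (P.eps * Site.tdist y y')) → ∀ y : Site P 0,
            |∑ y' : Site P 0, P.eps ^ P.d *
                (d1Kernel P.eps⁻¹ μ (fun z z' => (P.eps ^ P.d)⁻¹ * (tower P a msq).G k z z') y y' * g y *
                  ((P.eps ^ P.d)⁻¹ * (tower P a msq).G k y y') * (g' y' - g' y))| ≤
              P.d * c₁ * c₁ * K' * radialConst P.d δ₁ 1 0 := by
  obtain ⟨δ₁, c₁, hδ₁, hc₁, H⟩ := gk_zero_torus_pointwise_eta 3 L le_rfl hL ha hmsq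
  refine ⟨δ₁, c₁, hδ₁, hc₁, fun P hd hPL k hk1 hkK K' hK' g g' μ hg hg' y => ?_⟩
  have hε : 0 < P.eps := P.eps_pos
  have hε1 : P.eps ≤ 1 := B5Leaf237C0Torus.eps_le_one (P := P)
  -- the kernel bounds of `B3Bound323` for `G^η_k`, from `gk_zero_torus_pointwise_eta` through the dictionaries
  have hM : ∀ z z' : Site P 0, z' ≠ z →
      |d1Kernel P.eps⁻¹ μ (fun z z' => (P.eps ^ P.d)⁻¹ * (tower P a msq).G k z z') z z'| ≤
        c₁ * ((P.eps * supDist z z') ^ 2)⁻¹ * Real.exp (-(δ₁ * (P.eps * supDist z z'))) := by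
    intro z z' hne
    have h := (H P hd hPL k hk1 hkK z z' hne).2 μ
    rw [show (3 : ℕ) - 1 = 2 from rfl, inv_pow] at h
    rw [d1Kernel_etaKernel, ← T_eq_supDist P]
    exact h
  have hG : ∀ z z' : Site P 0, z' ≠ z →
      |(P.eps ^ P.d)⁻¹ * (tower P a msq).G k z z'| ≤
        c₁ * (P.eps * supDist z z')⁻¹ * Real.exp (-(δ₁ * (P.eps * supDist z z'))) := by
    intro z z' hne
    have h := (H P hd hPL k hk1 hkK z z' hne).1
    rw [show (3 : ℕ) - 2 = 1 from rfl, pow_one] at h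
    rw [← T_eq_supDist P]
    exact h
  exact abs_second323_le_uniform hd hε hε1 hδ₁ hc₁.le hc₁.le hK' _ _ g g' μ hM hG hg hg' y

/-- The same on r15's BRACKET: with `G^ξ_{j″}(0) = G^ξ_{j″} = G^η_k` the whole vertex coefficient `[(3.23)](y)` of r15's `bracket323`
(spacing `ε`) minus its first term `g(y)g′(y)Σ_{y′}ε³(∂^ε_μG^η_k)(y,y′)G^η_k(y,y′)` is bounded by the same constant
`3c₁²K′·radialConst 3 δ₁ 1 0`, for every volume, scale, `μ` and `y` (`B3Bound323.abs_bracket323_sub_first_le` + `radialConst_mono`).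
[cite: Balaban1983Higgs3, (3.23) p.439] -/
theorem bracket323_zero_torus (L : ℕ) (hL : Odd L ∧ 1 < L) {a : ℝ} (ha : 0 < a) {msq : ℝ} (hmsq : 0 ≤ msq) :
    ∃ δ₁ c₁ : ℝ, 0 < δ₁ ∧ 0 < c₁ ∧ ∀ (P : Params) (hd : P.d = 3), P.L = L →
      ∀ k : ℕ, 1 ≤ k → k ≤ P.K → ∀ (K' : ℝ), 0 ≤ K' →
        ∀ (g g' : SiteField P 0 ℝ) (μ : Fin P.d), (∀ y, |g y| ≤ 1) →
          (∀ y y' : Site P 0, |g' y' - g' y| ≤ K' * (P.eps * Site.tdist y y')) → ∀ y : Site P 0,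
            |bracket323 P.eps μ (fun z z' => (P.eps ^ P.d)⁻¹ * (tower P a msq).G k z z')
                  (fun z z' => (P.eps ^ P.d)⁻¹ * (tower P a msq).G k z z') g g' y -
                g y * g' y * ∑ y' : Site P 0, P.eps ^ P.d *
                  (d1Kernel P.eps⁻¹ μ (fun z z' => (P.eps ^ P.d)⁻¹ * (tower P a msq).G k z z') y y' *
                    ((P.eps ^ P.d)⁻¹ * (tower P a msq).G k y y'))| ≤
              P.d * c₁ * c₁ * K' * radialConst P.d δ₁ 1 0 := by
  obtain ⟨δ₁, c₁, hδ₁, hc₁, H⟩ := gk_zero_torus_pointwise_eta 3 L le_rfl hL ha hmsq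
  refine ⟨δ₁, c₁, hδ₁, hc₁, fun P hd hPL k hk1 hkK K' hK' g g' μ hg hg' y => ?_⟩
  have hε : 0 < P.eps := P.eps_pos
  have hε1 : P.eps ≤ 1 := B5Leaf237C0Torus.eps_le_one (P := P)
  have hM : ∀ z z' : Site P 0, z' ≠ z →
      |d1Kernel P.eps⁻¹ μ (fun z z' => (P.eps ^ P.d)⁻¹ * (tower P a msq).G k z z') z z'| ≤
        c₁ * ((P.eps * supDist z z') ^ 2)⁻¹ * Real.exp (-(δ₁ * (P.eps * supDist z z'))) := by
    intro z z' hne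
    have h := (H P hd hPL k hk1 hkK z z' hne).2 μ
    rw [show (3 : ℕ) - 1 = 2 from rfl, inv_pow] at h
    rw [d1Kernel_etaKernel, ← T_eq_supDist P]
    exact h
  have hG : ∀ z z' : Site P 0, z' ≠ z →
      |(P.eps ^ P.d)⁻¹ * (tower P a msq).G k z z'| ≤
        c₁ * (P.eps * supDist z z')⁻¹ * Real.exp (-(δ₁ * (P.eps * supDist z z'))) := by
    intro z z' hne
    have h := (H P hd hPL k hk1 hkK z z' hne).1
    rw [show (3 : ℕ) - 2 = 1 from rfl, pow_one] at h
    rw [← T_eq_supDist P]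
    exact h
  have h1 := abs_bracket323_sub_first_le hd hε hδ₁ hc₁.le hc₁.le hK' _ _ g g' μ hM hG hg hg' y
  refine h1.trans ?_
  have hm := radialConst_mono P.d hδ₁ hε1 0
  have hc0 : 0 ≤ (P.d : ℝ) * c₁ * c₁ * K' := by positivity
  exact mul_le_mul_of_nonneg_left hm hc0

end Instance

end

end Literature.MathematicalPhysics.QuantumFieldTheory.Balaban1983to89.B3Bound323ZeroTorus
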